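import Summits.CriticalPhenomena.PercolationContinuityZ3.Theorems.FK.DLRBadEventLocality
import Summits.CriticalPhenomena.PercolationContinuityZ3.Theorems.FK.InfiniteVolumeDLRBoxExact
import Summits.CriticalPhenomena.PercolationContinuityZ3.Theorems.FK.InfiniteVolumeDLRMeasures
import Summits.CriticalPhenomena.PercolationContinuityZ3.Theorems.FK.InfiniteVolumeDLR
import HarnessLib

/-!
# FK-continuity cell, FO-10a: the specification kernel lies between the free and the wired region laws —
# `φ⁰_{Λ,p,q}(A) ≤ φ^ξ_{Λ,p,q}(A) ≤ φ¹_{Λ,p,q}(A)` for increasing `A` (Grimmett 2006, Lemma (4.14)(b) for (4.12))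

Registered R75 (cell INBOX l.5563, 2026-08-23); registry row FO-10a-g335d; label DLS-B (coordinator fk-4 g153).
Cell `fk-continuity` (bschramm), row FO-10a (domain-Markov + comparison layer over FO-06); support file for the
FK-continuity transplant (`--supports stmt-CriticalPhenomena-4575`); builds on p205010 (kernel theorem, internal audit
signed; external expert review pending). Pure proofs; no definitions, no named facts, no sorries; general `d`.

Grimmett 2006, Lemma (4.14)(b) with (4.12)–(4.13): for every boundary condition `ξ`, the random-cluster measure
`φ^ξ_{Λ,p,q}` of the finite region `Λ` (the tree's specification kernel `rcCondProb p q Λ ξ`, FO-06b-6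
`InfiniteVolumeDLRDefs.lean`) is sandwiched between the free and the wired measures of `Λ` on increasing events
(`q ≥ 1`). Here WITHOUT a Holley argument on the kernel: for a FINITE lattice boundary condition `ζ` off `E_Λ`
(inside `Λ_m²`), FO-06b-6's exact box-kernel identity (`rcBoxLaw_real_cylEvent_inter_inter_compl_regionBadEvent_eq_sum`,
Lemma (4.13) for the box law `φ⁰_{Λ_{m+1}}` read inside `Λ_m`, the configuration `ζ` being off the bad event
`D_m(Λ)`) identifies `φ^ζ_Λ(A)` with the conditional probability `φ⁰_{Λ_{m+1}}(A | ω = ζ on Λ_m² ∖ E_Λ, D_m(Λ)ᶜ)`, and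
FO-06a's finite sandwich (`regionFreeReal_mul_rcBoxMeasure_le`, `rcBoxMeasure_le_regionWiredReal_mul`) bounds that
conditional probability by `φ⁰_Λ(A)` and `φ¹_Λ(A)`; a general lattice configuration `ξ` is reduced to a finite one in
the companion `DLRSandwich.lean` (the kernel sees `ξ` only through the partition it induces on `Λ`).

* (`DLRBadEventLocality.lean`: `D_m(Λ)` is determined by the pairs of `Λ_{m+1}` off `E_Λ`; a configuration inside
  `Λ_m²` is off `D_m(Λ)`);
* `rcBoxLaw_real_inter_cyl_eq_sum_rcCondProb_mul` — for finite `ζ ⊆ Λ_m² ∖ E_Λ` and `A` determined by `E_Λ`: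
  `φ^b_{Λ_{m+1}}(A ∩ H) = (∑_{η ⊆ E_Λ, η ∈ A} φ^ζ_Λ(η)) · φ^b_{Λ_{m+1}}(H)`, `H = {ω = ζ on Λ_m² ∖ E_Λ} ∖ D_m(Λ)`;
* **`regionFreeReal_le_sum_rcCondProb_coe`**, **`sum_rcCondProb_coe_le_regionWiredReal`** — the sandwich for
  finite lattice `ζ` off `E_Λ`, `0 < p < 1`, `q ≥ 1`, `A` increasing determined by `E_Λ`.

## References

* G. Grimmett, *The Random-Cluster Model*, Springer 2006 (`book:grimmett2006-random-cluster-model`): §4.2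
  (4.12)–(4.13), Lemma (4.13), Lemma (4.14)(b) [PDF pp. 70–72]; Lemma (4.39) [PDF p. 83]. [Grimmett2006]
-/

noncomputable section

open MeasureTheory Set Filter
open scoped Topology ENNReal

namespace Summit.CriticalPhenomena.PercolationContinuityZ3.Theorems.FK

open Literature.Probability.Percolation Literature.Probability.LatticeModels

variable {d : ℕ}

/-! ### The box law conditioned on a finite outside configuration is the kernel (Lemma (4.13), one cylinder) -/

section Kernel

open Finset

variable {p q : ℝ} {Λ : Finset (Site d)} {m : ℕ} {ζ : Finset (Sym2 (Site d))}

/-- **One outside cylinder**: for `Λ ⊆ Λ_m`, a finite configuration `ζ ⊆ Λ_m² ∖ E_Λ` and an inside pattern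
`η ⊆ E_Λ`, `φ^b_{Λ_{m+1}}({ω ∩ E_Λ = η} ∩ {ω = ζ on Λ_m² ∖ E_Λ} ∖ D_m(Λ)) = φ^ζ_Λ(η) · φ^b_{Λ_{m+1}}({ω = ζ on Λ_m² ∖ E_Λ} ∖ D_m(Λ))`
(`0 ≤ p ≤ 1`, `q > 0`; FO-06b-6's summed identity with a single non-vanishing term). [cite: Grimmett2006, Lemma (4.13)] -/
theorem rcBoxLaw_real_cylEvent_inter_cyl_eq (b : Bool) (hp : p ∈ Set.Icc (0 : ℝ) 1) (hq : 0 < q)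
    (hΛm : Λ ⊆ box d m) (hζ : ζ ⊆ (box d m).sym2 \ edgesIn (zdGraph d) Λ) {η : Finset (Sym2 (Site d))}
    (hη : η ⊆ edgesIn (zdGraph d) Λ) :
    (rcBoxLaw d b p q (m + 1)).real (cylEvent (edgesIn (zdGraph d) Λ) η ∩
        cylEvent ((box d m).sym2 \ edgesIn (zdGraph d) Λ) ζ ∩ (regionBadEvent Λ m)ᶜ) =
      rcCondProb p q Λ ↑ζ η * (rcBoxLaw d b p q (m + 1)).real
        (cylEvent ((box d m).sym2 \ edgesIn (zdGraph d) Λ) ζ ∩ (regionBadEvent Λ m)ᶜ) := by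
  classical
  set E' := (box d m).sym2 \ edgesIn (zdGraph d) Λ with hE'
  have hT : Disjoint (↑E' : Set (Sym2 (Site d))) ↑(edgesIn (zdGraph d) Λ) := by
    rw [hE', Finset.coe_sdiff]; exact disjoint_sdiff_left
  rw [rcBoxLaw_real_cylEvent_inter_inter_compl_regionBadEvent_eq_sum b hp hq le_rfl hΛm hη
    (determinedBy_cylEvent E' ζ) hT (measurableSet_cylEvent E' ζ)]
  rw [Finset.sum_eq_single_of_mem ζ (Finset.mem_powerset.2 hζ)]
  · rw [Set.inter_assoc, Set.inter_comm ((regionBadEvent Λ m)ᶜ), ← Set.inter_assoc, Set.inter_self]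
  · intro ζ' hζ' hne
    have hempty : cylEvent E' ζ ∩ (regionBadEvent Λ m)ᶜ ∩ cylEvent E' ζ' = ∅ := by
      refine Set.eq_empty_of_forall_notMem fun ω hω => hne ?_
      have h1 := hω.1.1
      have h2 := hω.2
      rw [mem_cylEvent_iff] at h1 h2
      ext e
      refine ⟨fun he => ?_, fun he => ?_⟩
      · have heE : e ∈ E' := Finset.mem_powerset.1 hζ' he
        exact (h1 e heE).1 ((h2 e heE).2 he)
      · have heE : e ∈ E' := hζ he
        exact (h2 e heE).1 ((h1 e heE).2 he)
    rw [hempty, measureReal_empty, mul_zero]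

open Classical in
/-- **Conditional law of an `E_Λ`-local event**: for `A` determined by `E_Λ` (measurable) and `H` as above,
`φ^b_{Λ_{m+1}}(A ∩ H) = (∑_{η ⊆ E_Λ, η ∈ A} φ^ζ_Λ(η)) · φ^b_{Λ_{m+1}}(H)`. [cite: Grimmett2006, Lemma (4.13)] -/
theorem rcBoxLaw_real_inter_cyl_eq_sum_rcCondProb_mul (b : Bool) (hp : p ∈ Set.Icc (0 : ℝ) 1) (hq : 0 < q)
    (hΛm : Λ ⊆ box d m) (hζ : ζ ⊆ (box d m).sym2 \ edgesIn (zdGraph d) Λ) {A : Set (BondConfig (Site d))}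
    (hAΛ : DeterminedBy A ↑(edgesIn (zdGraph d) Λ)) (hAm : MeasurableSet A) :
    (rcBoxLaw d b p q (m + 1)).real (A ∩ (cylEvent ((box d m).sym2 \ edgesIn (zdGraph d) Λ) ζ ∩ (regionBadEvent Λ m)ᶜ)) =
      (∑ η ∈ ((edgesIn (zdGraph d) Λ).powerset.filter
          (fun η : Finset (Sym2 (Site d)) => ((η : Set (Sym2 (Site d))) ∈ A))), rcCondProb p q Λ ↑ζ η) *
        (rcBoxLaw d b p q (m + 1)).real (cylEvent ((box d m).sym2 \ edgesIn (zdGraph d) Λ) ζ ∩ (regionBadEvent Λ m)ᶜ) := by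
  classical
  set μ := rcBoxLaw d b p q (m + 1) with hμ
  set H' := cylEvent ((box d m).sym2 \ edgesIn (zdGraph d) Λ) ζ ∩ (regionBadEvent Λ m)ᶜ with hH'
  haveI : IsProbabilityMeasure μ := by
    rw [hμ, rcBoxLaw]
    haveI : IsProbabilityMeasure (rcBoxMeasure d b p q (m + 1)) := isProbabilityMeasure_rcMeasure _ hp hq _
    exact Measure.isProbabilityMeasure_map (measurable_of_finite _).aemeasurable
  have hH'm : MeasurableSet H' :=
    (measurableSet_cylEvent _ _).inter (measurableSet_regionBadEvent Λ m).compl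
  -- decompose `A ∩ H'` along the inside patterns
  have hdec := measure_eq_sum_measure_cylEvent_inter μ (edgesIn (zdGraph d) Λ) (hAm.inter hH'm)
  have hreal : μ.real (A ∩ H') = ∑ η ∈ (edgesIn (zdGraph d) Λ).powerset,
      μ.real (cylEvent (edgesIn (zdGraph d) Λ) η ∩ (A ∩ H')) := by
    rw [measureReal_def, hdec, ENNReal.toReal_sum fun η _ => measure_ne_top _ _]
    rfl
  -- on the cylinder of `η`, membership in `A` is decided by `η`
  have hcyl : ∀ η ∈ (edgesIn (zdGraph d) Λ).powerset,
      cylEvent (edgesIn (zdGraph d) Λ) η ∩ (A ∩ H') =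
        if (↑η : BondConfig (Site d)) ∈ A then cylEvent (edgesIn (zdGraph d) Λ) η ∩ H' else ∅ := by
    intro η hη
    have key : ∀ ω ∈ cylEvent (edgesIn (zdGraph d) Λ) η, (ω ∈ A ↔ (↑η : BondConfig (Site d)) ∈ A) := by
      intro ω hω
      refine (determinedBy_iff _ _).1 hAΛ _ _ ?_
      ext e
      simp only [Set.mem_inter_iff, Finset.mem_coe]
      rw [mem_cylEvent_iff] at hω
      constructor
      · rintro ⟨he, heU⟩; exact ⟨(hω e heU).1 he, heU⟩
      · rintro ⟨he, heU⟩; exact ⟨(hω e heU).2 he, heU⟩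
    split_ifs with hA
    · ext ω
      simp only [Set.mem_inter_iff]
      exact ⟨fun ⟨h1, _, h3⟩ => ⟨h1, h3⟩, fun ⟨h1, h3⟩ => ⟨h1, (key ω h1).2 hA, h3⟩⟩
    · refine Set.eq_empty_of_forall_notMem fun ω hω => hA ((key ω hω.1).1 hω.2.1)
  rw [hreal, Finset.sum_filter, Finset.sum_mul]
  refine Finset.sum_congr rfl fun η hη => ?_
  rw [hcyl η hη]
  split_ifs with hA
  · rw [← Set.inter_assoc]
    exact rcBoxLaw_real_cylEvent_inter_cyl_eq b hp hq hΛm hζ (Finset.mem_powerset.1 hη)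
  · rw [measureReal_empty, zero_mul]

end Kernel

/-! ### The sandwich for a finite lattice boundary condition -/

section Sandwich

open Finset

variable {p q : ℝ} {Λ : Finset (Site d)} {m : ℕ} {ζ : Finset (Sym2 (Site d))}

/-- The conditioning event `{ω = ζ on Λ_m² ∖ E_Λ} ∖ D_m(Λ)` is determined by the pairs of `Λ_{m+1}` off `E_Λ`.
[cite: Grimmett2006, Lemma (4.39)] -/
theorem determinedBy_cyl_inter_compl_regionBadEvent (Λ : Finset (Site d)) (m : ℕ) (ζ : Finset (Sym2 (Site d))) :
    DeterminedBy (cylEvent ((box d m).sym2 \ edgesIn (zdGraph d) Λ) ζ ∩ (regionBadEvent Λ m)ᶜ)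
      ↑((box d (m + 1)).sym2 \ edgesIn (zdGraph d) Λ) := by
  refine DeterminedBy.inter ((determinedBy_cylEvent _ ζ).mono fun e he => ?_) ?_
  · rw [Finset.mem_coe, Finset.mem_sdiff] at he ⊢
    refine ⟨?_, he.2⟩
    induction e using Sym2.ind with
    | _ u v =>
      rw [Finset.mk_mem_sym2_iff] at he ⊢
      exact ⟨box_mono d (Nat.le_succ m) he.1.1, box_mono d (Nat.le_succ m) he.1.2⟩
  · have h := determinedBy_regionBadEvent (d := d) Λ m
    rw [determinedBy_iff] at h ⊢
    intro ω ω' hωω'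
    rw [Set.mem_compl_iff, Set.mem_compl_iff, h ω ω' hωω']

/-- **The box sandwich, conditioned on `{ω = ζ on Λ_m² ∖ E_Λ} ∖ D_m(Λ)`** (FO-06a's finite sandwich read on the box
law): for `A` increasing determined by `E_Λ`,
`φ⁰_Λ(A) · φ^b_{Λ_{m+1}}(H) ≤ φ^b_{Λ_{m+1}}(A ∩ H) ≤ φ¹_Λ(A) · φ^b_{Λ_{m+1}}(H)`. [cite: Grimmett2006, Lemma (4.13) and Lemma (4.14)(b)] -/
theorem rcBoxLaw_real_inter_cyl_mem_Icc (b : Bool) (hp : p ∈ Set.Icc (0 : ℝ) 1) (hq : 1 ≤ q) (hΛm : Λ ⊆ box d m)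
    (ζ : Finset (Sym2 (Site d))) {A : Set (BondConfig (Site d))} (hA : IsUpperSet A)
    (hAΛ : DeterminedBy A ↑(edgesIn (zdGraph d) Λ)) :
    (rcBoxLaw d b p q (m + 1)).real (A ∩ (cylEvent ((box d m).sym2 \ edgesIn (zdGraph d) Λ) ζ ∩ (regionBadEvent Λ m)ᶜ)) ∈
      Set.Icc
        (regionFreeReal d p q Λ A *
          (rcBoxLaw d b p q (m + 1)).real (cylEvent ((box d m).sym2 \ edgesIn (zdGraph d) Λ) ζ ∩ (regionBadEvent Λ m)ᶜ))
        (regionWiredReal d p q Λ A *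
          (rcBoxLaw d b p q (m + 1)).real (cylEvent ((box d m).sym2 \ edgesIn (zdGraph d) Λ) ζ ∩ (regionBadEvent Λ m)ᶜ)) := by
  set H' := cylEvent ((box d m).sym2 \ edgesIn (zdGraph d) Λ) ζ ∩ (regionBadEvent Λ m)ᶜ with hH'
  set T := (box d (m + 1)).sym2 \ edgesIn (zdGraph d) Λ with hTdef
  have hH'det : DeterminedBy H' ↑T := determinedBy_cyl_inter_compl_regionBadEvent Λ m ζ
  have hT : Disjoint (↑T : Set (Sym2 (Site d))) ↑(edgesIn (zdGraph d) Λ) := by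
    rw [hTdef, Finset.coe_sdiff]; exact disjoint_sdiff_left
  have hΛn : Λ ⊆ box d (m + 1) := hΛm.trans (box_mono d (Nat.le_succ m))
  have hH'm : MeasurableSet H' := measurableSet_of_isLocalEvent_holds ⟨T, hH'det⟩
  have hAm : MeasurableSet A := measurableSet_of_isLocalEvent_holds ⟨_, hAΛ⟩
  rw [rcBoxLaw_real_apply b p q (m + 1) (hAm.inter hH'm), rcBoxLaw_real_apply b p q (m + 1) hH'm]
  exact ⟨regionFreeReal_mul_rcBoxMeasure_le hp hq b hΛn T hA hAΛ hT hH'det,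
    rcBoxMeasure_le_regionWiredReal_mul hp hq b hΛn T hA hAΛ hT hH'det⟩

/-- Random-cluster weights are positive for `0 < p < 1`, `q > 0`. [cite: Grimmett2006, §1.2 eq. (1.2)] -/
theorem rcWeight_pos {V : Type*} [Fintype V] [DecidableEq V] (G : SimpleGraph V) [DecidableRel G.Adj] {p q : ℝ}
    (hp : p ∈ Set.Ioo (0 : ℝ) 1) (hq : 0 < q) (B : Set V) (ω : Finset (Sym2 V)) : 0 < rcWeight G p q B ω := by
  unfold rcWeight
  exact mul_pos (mul_pos (pow_pos hp.1 _) (pow_pos (by linarith [hp.2]) _)) (pow_pos hq _)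

/-- **The conditioning event has positive probability** (`0 < p < 1`, `q > 0`, `ζ ⊆ Λ_m²` made of lattice edges):
`φ^b_{Λ_{m+1}}({ω = ζ on Λ_m² ∖ E_Λ} ∖ D_m(Λ)) > 0` — it contains the full cylinder `{ω = ζ on Λ_{m+1}²}`, whose box
configuration has positive weight. [cite: Grimmett2006, Thm. (3.1) (finite energy) with Lemma (4.39)] -/
theorem rcBoxLaw_real_cyl_inter_compl_regionBadEvent_pos (b : Bool) (hp : p ∈ Set.Ioo (0 : ℝ) 1) (hq : 0 < q)
    (hΛm : Λ ⊆ box d m) (hζm : ζ ⊆ (box d m).sym2) (hζE : ∀ e ∈ ζ, e ∈ (zdGraph d).edgeSet) :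
    0 < (rcBoxLaw d b p q (m + 1)).real
      (cylEvent ((box d m).sym2 \ edgesIn (zdGraph d) Λ) ζ ∩ (regionBadEvent Λ m)ᶜ) := by
  classical
  have hp' : p ∈ Set.Icc (0 : ℝ) 1 := ⟨hp.1.le, hp.2.le⟩
  set n := m + 1 with hn
  set F := (box d n).sym2 with hF
  set H' := cylEvent ((box d m).sym2 \ edgesIn (zdGraph d) Λ) ζ ∩ (regionBadEvent Λ m)ᶜ with hH'
  have hζF : ζ ⊆ F := fun e he => by
    have h := hζm he
    induction e using Sym2.ind with
    | _ u v =>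
      rw [Finset.mk_mem_sym2_iff] at h ⊢
      exact ⟨box_mono d (Nat.le_succ m) h.1, box_mono d (Nat.le_succ m) h.2⟩
  -- the pairs of `Λ_m² ∖ E_Λ` are pairs of `Λ_{m+1}`
  have hEF : ∀ e ∈ (box d m).sym2 \ edgesIn (zdGraph d) Λ, e ∈ F := by
    intro e he
    have h1 := (Finset.mem_sdiff.1 he).1
    induction e using Sym2.ind with
    | _ u v =>
      rw [Finset.mk_mem_sym2_iff] at h1 ⊢
      exact ⟨box_mono d (Nat.le_succ m) h1.1, box_mono d (Nat.le_succ m) h1.2⟩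
  -- the full cylinder lies inside `H'`
  have hsub : cylEvent F ζ ⊆ H' := by
    intro ω hω
    rw [mem_cylEvent_iff] at hω
    refine ⟨mem_cylEvent_iff.2 fun e he => hω e (hEF e he), ?_⟩
    -- off the bad event: `ω` agrees with `↑ζ` on the determining pairs
    have hdet := determinedBy_regionBadEvent (d := d) Λ m
    have hagree : ω ∩ ↑((box d (m + 1)).sym2 \ edgesIn (zdGraph d) Λ) =
        (↑ζ : BondConfig (Site d)) ∩ ↑((box d (m + 1)).sym2 \ edgesIn (zdGraph d) Λ) := by
      ext e
      simp only [Set.mem_inter_iff, Finset.mem_coe, Finset.mem_sdiff]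
      constructor
      · rintro ⟨he, heF, heU⟩; exact ⟨(hω e heF).1 he, heF, heU⟩
      · rintro ⟨he, heF, heU⟩; exact ⟨(hω e heF).2 he, heF, heU⟩
    rw [Set.mem_compl_iff, (determinedBy_iff _ _).1 hdet ω ↑ζ hagree]
    exact coe_notMem_regionBadEvent_of_subset_sym2 hΛm hζm
  -- the box copy of `ζ`
  set G := finsetGraph (zdGraph d) (box d n) with hG
  set ζb : Finset (Sym2 ↥(box d n)) := G.edgeFinset.filter (fun e => Sym2.map Subtype.val e ∈ ζ) with hζb
  have hζbE : ζb ⊆ G.edgeFinset := Finset.filter_subset _ _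
  have himg : ζb.image (Sym2.map Subtype.val) = ζ := by
    ext e
    rw [Finset.mem_image]
    constructor
    · rintro ⟨e', he', rfl⟩
      exact (Finset.mem_filter.1 he').2
    · intro he
      have heF' := hζF he
      have heE := hζE e he
      induction e using Sym2.ind with
      | _ u v =>
        rw [Finset.mk_mem_sym2_iff] at heF'
        refine ⟨s(⟨u, heF'.1⟩, ⟨v, heF'.2⟩), Finset.mem_filter.2 ⟨?_, ?_⟩, ?_⟩
        · rw [SimpleGraph.mem_edgeFinset, SimpleGraph.mem_edgeSet, finsetGraph_adj_iff]
          exact (SimpleGraph.mem_edgeSet _).1 heE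
        · simpa using he
        · simp
  have hmem : liftEdges (box d n) (↑ζb : BondConfig ↥(box d n)) ∈ cylEvent F ζ := by
    rw [liftEdges_coe_eq_coe_image, himg, mem_cylEvent_iff]
    exact fun e _ => by rw [Finset.mem_coe]
  -- positivity of the full cylinder
  have hpos : 0 < (rcBoxLaw d b p q n).real (cylEvent F ζ) := by
    rw [rcBoxLaw_real_apply b p q n (measurableSet_cylEvent F ζ)]
    unfold rcBoxMeasure
    have hZ := rcPartitionFunction_pos G hp' hq (boxBC d b n)
    rw [rcMeasure_real_apply G hp' hq (boxBC d b n)]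
    set f : Finset (Sym2 ↥(box d n)) → ℝ := fun ω =>
      if (↑ω : BondConfig ↥(box d n)) ∈ liftEdges (box d n) ⁻¹' cylEvent F ζ then
        rcWeight G p q (boxBC d b n) ω / rcPartitionFunction G p q (boxBC d b n) else 0 with hf
    have hterm : ∀ ω ∈ G.edgeFinset.powerset, 0 ≤ f ω := by
      intro ω _
      simp only [hf]
      split_ifs
      · exact div_nonneg (rcWeight_nonneg G hp' hq.le _ ω) hZ.le
      · exact le_rfl
    have hle := Finset.single_le_sum hterm (Finset.mem_powerset.2 hζbE)
    have hval : f ζb = rcWeight G p q (boxBC d b n) ζb / rcPartitionFunction G p q (boxBC d b n) := by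
      simp only [hf]
      rw [if_pos (by exact hmem)]
    rw [hval] at hle
    exact lt_of_lt_of_le (div_pos (rcWeight_pos G hp hq (boxBC d b n) ζb) hZ) hle
  haveI : IsProbabilityMeasure (rcBoxLaw d b p q n) := by
    rw [rcBoxLaw]
    haveI : IsProbabilityMeasure (rcBoxMeasure d b p q n) := isProbabilityMeasure_rcMeasure _ hp' hq _
    exact Measure.isProbabilityMeasure_map (measurable_of_finite _).aemeasurable
  exact hpos.trans_le (measureReal_mono hsub (measure_ne_top _ _))

/-- A finite set of pairs and a finite region lie in a common box. [folklore] -/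
theorem exists_box_of_finite (Λ : Finset (Site d)) (ζ : Finset (Sym2 (Site d))) :
    ∃ m, Λ ⊆ box d m ∧ ζ ⊆ (box d m).sym2 := by
  refine ⟨max (Λ.sup siteRad) (ζ.sup pairRad), subset_box_of_sup_siteRad_le (le_max_left _ _), fun e he => ?_⟩
  have h := mem_box_of_pairRad_le ((Finset.le_sup he).trans (le_max_right (Λ.sup siteRad) (ζ.sup pairRad)))
  induction e using Sym2.ind with
  | _ u v => exact Finset.mk_mem_sym2_iff.2 ⟨h u (Sym2.mem_mk_left u v), h v (Sym2.mem_mk_right u v)⟩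

open Classical in
/-- **Lemma (4.14)(b) for the specification kernel, finite boundary condition, lower half**: for a finite
configuration `ζ` of lattice edges off `E_Λ` and an increasing event `A` determined by `E_Λ`,
`φ⁰_{Λ,p,q}(A) ≤ φ^ζ_{Λ,p,q}(A) = ∑_{η ⊆ E_Λ, η ∈ A} φ^ζ_{Λ,p,q}(η)` (`0 < p < 1`, `q ≥ 1`).
[cite: Grimmett2006, Lemma (4.14)(b) with (4.12)–(4.13)] -/
theorem regionFreeReal_le_sum_rcCondProb_coe (hp : p ∈ Set.Ioo (0 : ℝ) 1) (hq : 1 ≤ q) {Λ : Finset (Site d)}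
    {ζ : Finset (Sym2 (Site d))} (hζE : ∀ e ∈ ζ, e ∈ (zdGraph d).edgeSet)
    (hζU : Disjoint ζ (edgesIn (zdGraph d) Λ)) {A : Set (BondConfig (Site d))} (hA : IsUpperSet A)
    (hAΛ : DeterminedBy A ↑(edgesIn (zdGraph d) Λ)) :
    regionFreeReal d p q Λ A ≤
      ∑ η ∈ ((edgesIn (zdGraph d) Λ).powerset.filter
        (fun η : Finset (Sym2 (Site d)) => ((η : Set (Sym2 (Site d))) ∈ A))), rcCondProb p q Λ ↑ζ η := by
  have hp' : p ∈ Set.Icc (0 : ℝ) 1 := ⟨hp.1.le, hp.2.le⟩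
  have hq0 : 0 < q := one_pos.trans_le hq
  obtain ⟨m, hΛm, hζm⟩ := exists_box_of_finite Λ ζ
  have hζ : ζ ⊆ (box d m).sym2 \ edgesIn (zdGraph d) Λ :=
    fun e he => Finset.mem_sdiff.2 ⟨hζm he, fun heU => Finset.disjoint_left.1 hζU he heU⟩
  have hAm : MeasurableSet A := measurableSet_of_isLocalEvent_holds ⟨_, hAΛ⟩
  have hpos := rcBoxLaw_real_cyl_inter_compl_regionBadEvent_pos false hp hq0 hΛm hζm hζE
  have h1 := (rcBoxLaw_real_inter_cyl_mem_Icc false hp' hq hΛm ζ hA hAΛ).1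
  rw [rcBoxLaw_real_inter_cyl_eq_sum_rcCondProb_mul false hp' hq0 hΛm hζ hAΛ hAm] at h1
  exact le_of_mul_le_mul_right h1 hpos

open Classical in
/-- **Lemma (4.14)(b) for the specification kernel, finite boundary condition, upper half**:
`∑_{η ⊆ E_Λ, η ∈ A} φ^ζ_{Λ,p,q}(η) ≤ φ¹_{Λ,p,q}(A)` under the same hypotheses. [cite: Grimmett2006, Lemma (4.14)(b) with (4.12)–(4.13)] -/
theorem sum_rcCondProb_coe_le_regionWiredReal (hp : p ∈ Set.Ioo (0 : ℝ) 1) (hq : 1 ≤ q) {Λ : Finset (Site d)}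
    {ζ : Finset (Sym2 (Site d))} (hζE : ∀ e ∈ ζ, e ∈ (zdGraph d).edgeSet)
    (hζU : Disjoint ζ (edgesIn (zdGraph d) Λ)) {A : Set (BondConfig (Site d))} (hA : IsUpperSet A)
    (hAΛ : DeterminedBy A ↑(edgesIn (zdGraph d) Λ)) :
    ∑ η ∈ ((edgesIn (zdGraph d) Λ).powerset.filter
        (fun η : Finset (Sym2 (Site d)) => ((η : Set (Sym2 (Site d))) ∈ A))), rcCondProb p q Λ ↑ζ η ≤
      regionWiredReal d p q Λ A := by
  have hp' : p ∈ Set.Icc (0 : ℝ) 1 := ⟨hp.1.le, hp.2.le⟩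
  have hq0 : 0 < q := one_pos.trans_le hq
  obtain ⟨m, hΛm, hζm⟩ := exists_box_of_finite Λ ζ
  have hζ : ζ ⊆ (box d m).sym2 \ edgesIn (zdGraph d) Λ :=
    fun e he => Finset.mem_sdiff.2 ⟨hζm he, fun heU => Finset.disjoint_left.1 hζU he heU⟩
  have hAm : MeasurableSet A := measurableSet_of_isLocalEvent_holds ⟨_, hAΛ⟩
  have hpos := rcBoxLaw_real_cyl_inter_compl_regionBadEvent_pos false hp hq0 hΛm hζm hζE
  have h2 := (rcBoxLaw_real_inter_cyl_mem_Icc false hp' hq hΛm ζ hA hAΛ).2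
  rw [rcBoxLaw_real_inter_cyl_eq_sum_rcCondProb_mul false hp' hq0 hΛm hζ hAΛ hAm] at h2
  exact le_of_mul_le_mul_right h2 hpos

end Sandwich

end Summit.CriticalPhenomena.PercolationContinuityZ3.Theorems.FK

end
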